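import Summits.KontsevichZagierPeriods.KontsevichZagierPeriods.Theses.HurwitzMicroSectors
import Summits.KontsevichZagierPeriods.KontsevichZagierPeriods.Theorems.HurwitzMicroSectorsNormalFormPrinciplePiBoxTransfer

/-! TTRL-lite variant V2338 of stmt-KontsevichZagierPeriods-3869

Variant V2338 = `stub_boxRigidity` (BoxRigidity: two box-rational representations — domain the open
unit box, integrand `p/q` over `ℚ` — with equal values are KZ-equivalent) under the JOINT bound
`bound_nat:m≤2; bound_nat:m'≤2`. Verdict of the attempt seat: **open** — this file is the
exact-strength certificate, not a proof of the variant. A joint bound pins the leaf to ONE dimension: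
V2338 is EQUIVALENT to BoxVanishing in dimension `2` (`stub_boxRigidity_var2338_iff_boxVanishing_two`):
every representation `[(0,1)², p/q]`, `p, q ∈ ℚ[x,y]`, `q ≠ 0` on the open box, `p/q ∈ L¹`, of value
`0` is a Kontsevich–Zagier relation — pad both representations to the common box by unit intervals
(`pad_le`, Newton–Leibniz + null faces) and subtract the integrands (`sub_same`, rule 1b)) one way,
compare with the zero representation on the `0`-box the other way. That is Conjecture 1 for
box-rational periods of dimension exactly `2`, the FIRST OPEN dimension: the two-sided instance
`m, m' ≤ 1` is the theorem `boxRigidity_of_le_one` (Baker), while dimension `2` contains, for every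
`c : ℚ`, the instance `G = c → [(0,1)², 1/(1+x²y²)] ∼ [pt, c]` (`G` = Catalan's constant — a proof is an
irrationality proof of `G` unless such a chain exists) and the joint `π²`/`log 2` layer
(`[c/(1−xy)]` against `[c'/(1−xy²)]`, values `cπ²/6`, `2c' log 2`), whose rigidity input
`Indep_ℚ(1, π², log 2)` is open. V2338 is the WEAKEST open joint-bound variant
(`stub_boxRigidity_var2338_of_boxVanishing`: BoxVanishing in any dimension `K ≥ 2` implies it), and
`KontsevichZagierPeriods → V2338` (`stub_boxRigidity_var2338_of_statement`), so a refutation would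
refute the Summit; no argument in the tree or the literature proves or refutes it.
Source: M. Kontsevich, D. Zagier, *Periods* (2001), §1.2 Conjecture 1 and rules 1)–3).
Pure proof file, no definitions. -/

-- `Summit.<Summit>.<Problem>` is the tree's mandated summit-side namespace (CONVENTIONS §2); for this
-- single-conjunct summit the two coincide, so the duplicate is deliberate.
set_option linter.dupNamespace false

noncomputable section

namespace Summit.KontsevichZagierPeriods.KontsevichZagierPeriods.Theorems

open MeasureTheory Set
open Literature.NumberTheory.Transcendental Literature.NumberTheory.Transcendental.KZ
open Summit.KontsevichZagierPeriods.KontsevichZagierPeriods.Theses.HurwitzMicroSectors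
open Summit.KontsevichZagierPeriods.HurwitzMicroSectors.NormalFormPrinciple.PiBox
open Summit.KontsevichZagierPeriods.HurwitzMicroSectors.NormalFormPrinciple.PiBox.stub_boxCombineAux

/-! ## The variant V2338: Conjecture 1 for box-rational periods of dimension 2 -/

/-- **BoxVanishing in any dimension `K ≥ 2` ⇒ V2338**: pad both representations to the `K`-box
(`pad_le`), subtract the integrands on the common box (`sub_same`, rule 1b)); the difference
representation has value `0` by soundness, hence is a relation. So the variant is the weakest of the
open joint-bound specialisations of `stub_boxRigidity`. [cite: KontsevichZagier2001, §1.2 Conjecture 1] -/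
theorem stub_boxRigidity_var2338_of_boxVanishing {K : ℕ} (hK : 2 ≤ K)
    (hvan : ∀ N : IntegralRep K, N.domain = {x | ∀ i, x i ∈ Set.Ioo (0:ℝ) 1} → N.IsRational →
      N.value = 0 → of N ∈ relations) :
    ∀ (m m' : ℕ) (N : IntegralRep m) (N' : IntegralRep m'), m ≤ 2 → m' ≤ 2 → N.domain = {x | ∀ i, x i ∈ Set.Ioo (0:ℝ) 1} → N.IsRational → N'.domain = {x | ∀ i, x i ∈ Set.Ioo (0:ℝ) 1} → N'.IsRational → N.value = N'.value → Equivalent N N' := by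
  intro m m' N N' hm hm' hNd hNr hN'd hN'r hv
  obtain ⟨R₁, h₁d, h₁r, h₁⟩ := pad_le (hm.trans hK) N hNd hNr
  obtain ⟨R₂, h₂d, h₂r, h₂⟩ := pad_le (hm'.trans hK) N' hN'd hN'r
  obtain ⟨M, hMd, hMr, hM⟩ := sub_same R₁ R₂ h₁d h₁r h₂d h₂r
  have hMv : M.value = 0 := by
    have e₁ := relations_le_ker_eval_holds h₁
    have e₂ := relations_le_ker_eval_holds h₂
    have e := relations_le_ker_eval_holds hM
    simp only [AddMonoidHom.mem_ker, map_sub, eval_of] at e₁ e₂ e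
    linarith
  have e : of N - of N' = (of N - of R₁) - (of N' - of R₂) + (of R₁ - of R₂ - of M) + of M := by abel
  show of N - of N' ∈ relations
  rw [e]
  exact relations.add_mem (relations.add_mem (relations.sub_mem h₁ h₂) hM) (hvan M hMd hMr hMv)

/-- **V2338 ⇒ BoxVanishing in dimension `2`**: compare a box-rational representation on `(0,1)²`
of value `0` with the zero representation on the `0`-box (box-rational, value `0`, itself a
relation). [cite: KontsevichZagier2001, §1.2 Conjecture 1] -/
theorem boxVanishing_two_of_stub_boxRigidity_var2338
    (h : ∀ (m m' : ℕ) (N : IntegralRep m) (N' : IntegralRep m'), m ≤ 2 → m' ≤ 2 → N.domain = {x | ∀ i, x i ∈ Set.Ioo (0:ℝ) 1} → N.IsRational → N'.domain = {x | ∀ i, x i ∈ Set.Ioo (0:ℝ) 1} → N'.IsRational → N.value = N'.value → Equivalent N N')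
    (N : IntegralRep 2) (hNd : N.domain = {x | ∀ i, x i ∈ Set.Ioo (0:ℝ) 1}) (hNr : N.IsRational)
    (hv : N.value = 0) : of N ∈ relations := by
  obtain ⟨Z, hZd, hZi⟩ := exists_zeroRep (isSemialgebraic_box 0)
  have hZ : of Z ∈ relations := of_mem_relations_of_eqOn_zero Z (by simp [hZi, EqOn])
  have hZv : Z.value = 0 := by simp [IntegralRep.value, hZi]
  have hZr : Z.IsRational := ⟨0, 1, fun x _ => by simp, fun x _ => by simp [hZi]⟩
  have h' : of N - of Z ∈ relations :=
    h 2 0 N Z le_rfl (Nat.zero_le 2) hNd hNr hZd hZr (by rw [hv, hZv])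
  simpa using relations.add_mem h' hZ

/-- **V2338 ⟺ BoxVanishing in dimension `2`** (every box-rational representation on `(0,1)²` of
value `0` is a relation): Conjecture 1 for box-rational periods of dimension exactly `2` — the first
open dimension (`m, m' ≤ 1` is `boxRigidity_of_le_one`, by Baker). [cite: KontsevichZagier2001, §1.2 Conjecture 1] -/
theorem stub_boxRigidity_var2338_iff_boxVanishing_two :
    (∀ (m m' : ℕ) (N : IntegralRep m) (N' : IntegralRep m'), m ≤ 2 → m' ≤ 2 → N.domain = {x | ∀ i, x i ∈ Set.Ioo (0:ℝ) 1} → N.IsRational → N'.domain = {x | ∀ i, x i ∈ Set.Ioo (0:ℝ) 1} → N'.IsRational → N.value = N'.value → Equivalent N N') ↔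
    (∀ N : IntegralRep 2, N.domain = {x | ∀ i, x i ∈ Set.Ioo (0:ℝ) 1} → N.IsRational →
      N.value = 0 → of N ∈ relations) :=
  ⟨boxVanishing_two_of_stub_boxRigidity_var2338, stub_boxRigidity_var2338_of_boxVanishing le_rfl⟩

/-- **BoxVanishing descends from dimension `2`**: under V2338 every box-rational representation of
dimension `j ≤ 2` with value `0` is a relation (pad it to the `2`-box; same value by soundness).
[cite: KontsevichZagier2001, §1.2] -/
theorem boxVanishing_le_two_of_stub_boxRigidity_var2338 {j : ℕ} (hj : j ≤ 2)
    (h : ∀ (m m' : ℕ) (N : IntegralRep m) (N' : IntegralRep m'), m ≤ 2 → m' ≤ 2 → N.domain = {x | ∀ i, x i ∈ Set.Ioo (0:ℝ) 1} → N.IsRational → N'.domain = {x | ∀ i, x i ∈ Set.Ioo (0:ℝ) 1} → N'.IsRational → N.value = N'.value → Equivalent N N')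
    (N : IntegralRep j) (hNd : N.domain = {x | ∀ i, x i ∈ Set.Ioo (0:ℝ) 1}) (hNr : N.IsRational)
    (hv : N.value = 0) : of N ∈ relations := by
  obtain ⟨R, hRd, hRr, hR⟩ := pad_le hj N hNd hNr
  have hRv : R.value = 0 := by
    have e := relations_le_ker_eval_holds hR
    simp only [AddMonoidHom.mem_ker, map_sub, eval_of] at e
    linarith
  have := relations.add_mem hR (boxVanishing_two_of_stub_boxRigidity_var2338 h R hRd hRr hRv)
  rwa [sub_add_cancel] at this

/-- **`KontsevichZagierPeriods ⇒ V2338`**: the variant is a special case of Conjecture 1 for the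
tree's calculus — so a refutation of the variant would refute the Summit.
[cite: KontsevichZagier2001, §1.2 Conjecture 1] -/
theorem stub_boxRigidity_var2338_of_statement (h : _root_.KontsevichZagierPeriods) :
    ∀ (m m' : ℕ) (N : IntegralRep m) (N' : IntegralRep m'), m ≤ 2 → m' ≤ 2 → N.domain = {x | ∀ i, x i ∈ Set.Ioo (0:ℝ) 1} → N.IsRational → N'.domain = {x | ∀ i, x i ∈ Set.Ioo (0:ℝ) 1} → N'.IsRational → N.value = N'.value → Equivalent N N' :=
  fun m m' N N' _ _ => (leaves_of_statement h).1 m m' N N'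

/-- **The parent leaf ⇒ V2338** (the variant is a specialisation of `stub_boxRigidity`; the converse
is not claimed — the parent is BoxVanishing in ALL dimensions). [cite: KontsevichZagier2001, §1.2 Conjecture 1] -/
theorem stub_boxRigidity_var2338_of_parent
    (h : ∀ (m m' : ℕ) (N : IntegralRep m) (N' : IntegralRep m'), N.domain = {x | ∀ i, x i ∈ Set.Ioo (0:ℝ) 1} → N.IsRational → N'.domain = {x | ∀ i, x i ∈ Set.Ioo (0:ℝ) 1} → N'.IsRational → N.value = N'.value → Equivalent N N') :
    ∀ (m m' : ℕ) (N : IntegralRep m) (N' : IntegralRep m'), m ≤ 2 → m' ≤ 2 → N.domain = {x | ∀ i, x i ∈ Set.Ioo (0:ℝ) 1} → N.IsRational → N'.domain = {x | ∀ i, x i ∈ Set.Ioo (0:ℝ) 1} → N'.IsRational → N.value = N'.value → Equivalent N N' :=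
  fun m m' N N' _ _ => h m m' N N'

end Summit.KontsevichZagierPeriods.KontsevichZagierPeriods.Theorems
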